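import Summits.CriticalPhenomena.PercolationContinuityZ3.Theorems.PercAnnulusCrossingIICResistanceNashWilliams
import Mathlib.Combinatorics.SimpleGraph.Metric
import HarnessLib

/-!
# Bottlenecks of the arm, VIII: the unit flow along an open path — `R_eff(0 ↔ Λ(N)ᶜ) ≤ 2·(chemical distance to Λ(N)ᶜ)`, so `#bottlenecks ≤ 2·D_chem` (lane RSW3, p1 gen 27)

builds on p205010 (kernel theorem, internal audit signed; external expert review pending) — NOT used in this file (deterministic, every `d`).

RSW3 lane (LANE 3 `prim-rsw3`), seat `prim-rsw3-p1` (gen 27).  Helper file (`--supports stmt-CriticalPhenomena-4575`); no definitions,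
no sorries.  Memo `run/shared/lean/prim/rsw3/P1-QM.md` §40.

The converse companion of `…IICResistanceNashWilliams` (`#{pivotal open pairs of Λ(N)} ≤` energy of every unit flow from the root that is
divergence-free on `Λ(N) ∖ {0}`): the UNIT FLOW ALONG AN OPEN SELF-AVOIDING PATH `0 = x₀, x₁, …, x_ℓ = z` — `f(x_i, x_{i+1}) = 1`,
`f(x_{i+1}, x_i) = −1`, `0` elsewhere, written as `f(x,y) = #{i : (x_i,x_{i+1}) = (x,y)} − #{i : (x_i,x_{i+1}) = (y,x)}` so that no
definition is needed — is antisymmetric, supported on the open edges, has divergence `𝟙[x = 0] − 𝟙[x = z]` (telescoping, any walk), and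
energy `Σ f² ≤ 2ℓ` for a path:

* `sum_neighborFinset_dartFlow_eq` — the divergence identity for every walk of a subgraph of `ℤ^d`;
* `dartFlow_ne_zero`, `tsum_sq_dartFlow_le` — support and energy (`≤ 2·length` for paths);
* **`exists_unitFlow_energy_le_two_mul_length`** — for an open path from `0` to `z ∉ Λ(N)`: a unit flow from the root, divergence-free on
  `Λ(N) ∖ {0}`, with `Σ f² ≤ 2·length`; **`exists_unitFlow_energy_le_two_mul_dist`** — with the chemical distance `dist_{ω}(0,z)`;
* **`ncard_pivotal_le_two_mul_dist`** — hence, deterministically, **`#{e ∈ Λ(N).sym2 : ω ∖ {e} ∉ A_{N+1}} ≤ 2·dist_ω(0, z)` for every `z ∉ Λ(N)`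
  in the cluster of the root**: the bottlenecks of the arm below scale `N` number at most twice the chemical distance to leave `Λ(N)`
  (`log N ≲ #bottlenecks ≤ R_eff ≤ 2 D_chem` along the IIC, with `…IICResistanceGrowth` and gen 15's chemical-distance bounds).
References: R. Lyons, Y. Peres, *Probability on Trees and Networks* (2016) §2.4 (unit flow along a path; `R_eff ≤` length);
M. Heydenreich, R. van der Hofstad (2017) §14.3.
-/

noncomputable section

namespace Summit.CriticalPhenomena.PercolationContinuityZ3.Theorems.Crossing

open MeasureTheory Filter Topology Literature.Probability.Percolation Literature.Probability.LatticeModels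
open Literature.Probability.Percolation.DCT16
open scoped Literature.Probability.Percolation ENNReal

variable {d : ℕ}

/-! ## §1 The flow along a walk: divergence, support, energy -/

/-- **DIVERGENCE OF THE FLOW ALONG A WALK** (any walk `p : u → w` in a subgraph `H` of `ℤ^d`): with
`f(x,y) = #{darts of p equal to (x,y)} − #{darts equal to (y,x)}`, `Σ_{y ∼ x} f(x,y) = 𝟙[x = u] − 𝟙[x = w]` (telescoping).
[cite: LyonsPeres2016, §2.4] -/
theorem sum_neighborFinset_dartFlow_eq {H : SimpleGraph (Site d)} (hH : ∀ u v : Site d, H.Adj u v → (zdGraph d).Adj u v)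
    {u w : Site d} (p : H.Walk u w) (x : Site d) :
    ∑ y ∈ (zdGraph d).neighborFinset x,
        ((((p.darts.map SimpleGraph.Dart.toProd).count (x, y) : ℕ) : ℝ) - (((p.darts.map SimpleGraph.Dart.toProd).count (y, x) : ℕ) : ℝ)) =
      (if x = u then 1 else 0) - (if x = w then 1 else 0) := by
  classical
  induction p with
  | nil => simp
  | @cons a b c hab p' ih =>
    rw [SimpleGraph.Walk.darts_cons, List.map_cons]
    have hba : b ∈ (zdGraph d).neighborFinset a := (SimpleGraph.mem_neighborFinset _ _ _).2 (hH a b hab)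
    have hab' : a ∈ (zdGraph d).neighborFinset b := (SimpleGraph.mem_neighborFinset _ _ _).2 (hH a b hab).symm
    have hne : a ≠ b := (hH a b hab).ne
    -- split off the first dart
    have hcount : ∀ y : Site d,
        ((((⟨(a, b), hab⟩ : H.Dart).toProd :: p'.darts.map SimpleGraph.Dart.toProd).count (x, y) : ℕ) : ℝ) -
          ((((⟨(a, b), hab⟩ : H.Dart).toProd :: p'.darts.map SimpleGraph.Dart.toProd).count (y, x) : ℕ) : ℝ) =
        ((((p'.darts.map SimpleGraph.Dart.toProd).count (x, y) : ℕ) : ℝ) - (((p'.darts.map SimpleGraph.Dart.toProd).count (y, x) : ℕ) : ℝ)) +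
          ((if (a, b) = (x, y) then 1 else 0) - (if (a, b) = (y, x) then 1 else 0)) := by
      intro y
      rw [List.count_cons, List.count_cons]
      simp only [beq_iff_eq, Nat.cast_add, Nat.cast_ite, Nat.cast_one, Nat.cast_zero]
      ring
    rw [Finset.sum_congr rfl fun y _ => hcount y, Finset.sum_add_distrib, ih, Finset.sum_sub_distrib]
    -- the two indicator sums
    have h1 : ∑ y ∈ (zdGraph d).neighborFinset x, (if (a, b) = (x, y) then (1 : ℝ) else 0) = if x = a then 1 else 0 := by
      by_cases hxa : x = a
      · subst hxa
        rw [if_pos rfl]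
        rw [Finset.sum_eq_single b (fun y _ hyb => if_neg fun h => hyb (Prod.mk.injEq _ _ _ _ ▸ h).2.symm)
          (fun h => absurd hba h)]
        rw [if_pos rfl]
      · rw [if_neg hxa]
        exact Finset.sum_eq_zero fun y _ => if_neg fun h => hxa ((Prod.mk.injEq _ _ _ _ ▸ h).1.symm)
    have h2 : ∑ y ∈ (zdGraph d).neighborFinset x, (if (a, b) = (y, x) then (1 : ℝ) else 0) = if x = b then 1 else 0 := by
      by_cases hxb : x = b
      · subst hxb
        rw [if_pos rfl]
        rw [Finset.sum_eq_single a (fun y _ hya => if_neg fun h => hya (Prod.mk.injEq _ _ _ _ ▸ h).1.symm)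
          (fun h => absurd hab' h)]
        rw [if_pos rfl]
      · rw [if_neg hxb]
        exact Finset.sum_eq_zero fun y _ => if_neg fun h => hxb ((Prod.mk.injEq _ _ _ _ ▸ h).2.symm)
    rw [h1, h2]
    by_cases hxa : x = a <;> by_cases hxb : x = b <;> by_cases hxc : x = c <;> simp [hxa, hxb, hxc]

/-- **SUPPORT OF THE FLOW ALONG A WALK**: if `f(x,y) ≠ 0` then `(x,y)` or `(y,x)` is a dart of `p`, so `x ∼ y` in `H`. [folklore] -/
theorem dartFlow_ne_zero {V : Type*} [DecidableEq V] {H : SimpleGraph V} {u w : V} (p : H.Walk u w) {x y : V}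
    (h : ((((p.darts.map SimpleGraph.Dart.toProd).count (x, y) : ℕ) : ℝ) -
      (((p.darts.map SimpleGraph.Dart.toProd).count (y, x) : ℕ) : ℝ)) ≠ 0) : H.Adj x y := by
  by_contra hxy
  have h1 : (p.darts.map SimpleGraph.Dart.toProd).count (x, y) = 0 := by
    rw [List.count_eq_zero]
    intro hmem
    obtain ⟨e, -, he⟩ := List.mem_map.1 hmem
    exact hxy (by have := e.adj; rw [he] at this; exact this)
  have h2 : (p.darts.map SimpleGraph.Dart.toProd).count (y, x) = 0 := by
    rw [List.count_eq_zero]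
    intro hmem
    obtain ⟨e, -, he⟩ := List.mem_map.1 hmem
    exact hxy (by have := e.adj; rw [he] at this; exact this.symm)
  rw [h1, h2] at h
  simp at h

/-- **ENERGY OF THE FLOW ALONG A PATH**: for a path `p` (no repeated vertices), `f(x,y) ∈ {−1, 0, 1}`, the flow is square-summable and
`Σ_{(x,y)} f(x,y)² ≤ 2·length(p)`. [cite: LyonsPeres2016, §2.4] -/
theorem tsum_sq_dartFlow_le {V : Type*} [DecidableEq V] {H : SimpleGraph V} {u w : V} (p : H.Walk u w) (hp : p.IsPath) :
    Summable (fun q : V × V => ((((p.darts.map SimpleGraph.Dart.toProd).count (q.1, q.2) : ℕ) : ℝ) -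
      (((p.darts.map SimpleGraph.Dart.toProd).count (q.2, q.1) : ℕ) : ℝ)) ^ 2) ∧
    ∑' q : V × V, ((((p.darts.map SimpleGraph.Dart.toProd).count (q.1, q.2) : ℕ) : ℝ) -
      (((p.darts.map SimpleGraph.Dart.toProd).count (q.2, q.1) : ℕ) : ℝ)) ^ 2 ≤ 2 * (p.length : ℝ) := by
  classical
  set L : List (V × V) := p.darts.map SimpleGraph.Dart.toProd with hL
  have hnodup : L.Nodup :=
    (SimpleGraph.Walk.darts_nodup_of_support_nodup hp.support_nodup).map SimpleGraph.Dart.toProd_injective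
  have hle1 : ∀ q : V × V, L.count q ≤ 1 := fun q => List.nodup_iff_count_le_one.1 hnodup q
  -- pointwise: `f² ≤ count q + count q.swap`
  set g : V × V → ℝ := fun q => ((L.count q : ℕ) : ℝ) + ((L.count q.swap : ℕ) : ℝ) with hg
  have hpt : ∀ q : V × V, (((L.count (q.1, q.2) : ℕ) : ℝ) - ((L.count (q.2, q.1) : ℕ) : ℝ)) ^ 2 ≤ g q := by
    rintro ⟨x, y⟩
    simp only [hg, Prod.swap_prod_mk]
    have ha := hle1 (x, y)
    have hb := hle1 (y, x)
    interval_cases h1 : L.count (x, y) <;> interval_cases h2 : L.count (y, x) <;> norm_num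
  -- `g` has finite support and sums to `2·|L|`
  have hcount_supp : ∀ q : V × V, q ∉ L.toFinset → ((L.count q : ℕ) : ℝ) = 0 := by
    intro q hq
    rw [List.mem_toFinset] at hq
    rw [List.count_eq_zero.2 hq, Nat.cast_zero]
  have hsum1 : HasSum (fun q : V × V => ((L.count q : ℕ) : ℝ)) (L.length : ℝ) := by
    have h : HasSum (fun q : V × V => ((L.count q : ℕ) : ℝ)) (∑ q ∈ L.toFinset, ((L.count q : ℕ) : ℝ)) :=
      hasSum_sum_of_ne_finset_zero fun q hq => hcount_supp q hq
    have hlenR : ∑ q ∈ L.toFinset, ((L.count q : ℕ) : ℝ) = L.length := by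
      rw [Finset.sum_congr rfl (fun q hq => by rw [List.count_eq_one_of_mem hnodup (List.mem_toFinset.1 hq)])]
      simp [List.toFinset_card_of_nodup hnodup]
    rw [hlenR] at h
    exact h
  have hsum2 : HasSum (fun q : V × V => ((L.count q.swap : ℕ) : ℝ)) (L.length : ℝ) := by
    have h := (Equiv.prodComm V V).hasSum_iff.2 hsum1
    exact h
  have hgsum : HasSum g ((L.length : ℝ) + L.length) := hsum1.add hsum2
  have hnonneg : ∀ q : V × V, 0 ≤ (((L.count (q.1, q.2) : ℕ) : ℝ) - ((L.count (q.2, q.1) : ℕ) : ℝ)) ^ 2 := fun q => sq_nonneg _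
  have hsumm : Summable (fun q : V × V => (((L.count (q.1, q.2) : ℕ) : ℝ) - ((L.count (q.2, q.1) : ℕ) : ℝ)) ^ 2) :=
    Summable.of_nonneg_of_le hnonneg hpt hgsum.summable
  refine ⟨hsumm, ?_⟩
  have hlen : (L.length : ℝ) = p.length := by rw [hL, List.length_map, SimpleGraph.Walk.length_darts]
  calc ∑' q : V × V, (((L.count (q.1, q.2) : ℕ) : ℝ) - ((L.count (q.2, q.1) : ℕ) : ℝ)) ^ 2
      ≤ ∑' q : V × V, g q := hsumm.tsum_le_tsum hpt hgsum.summable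
    _ = (L.length : ℝ) + L.length := hgsum.tsum_eq
    _ = 2 * (p.length : ℝ) := by rw [hlen]; ring

/-! ## §2 The unit flow from the root along an open path leaving `Λ(N)` -/

/-- **THE UNIT FLOW ALONG AN OPEN PATH** (lattice configurations, every `d`, `N`): an open self-avoiding path `p` from `0` to a site `z ∉ Λ(N)`
carries a flow `f` which is antisymmetric, supported on the open edges, divergence-free on `Λ(N) ∖ {0}`, has unit out-flow at the root, and
energy `Σ f² ≤ 2·length(p)` — so `R_eff(0 ↔ Λ(N)ᶜ) ≤ 2·length`. [cite: LyonsPeres2016, §2.4] -/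
theorem exists_unitFlow_energy_le_two_mul_length {N : ℕ} {ω : BondConfig (Site d)} (hω : ω ⊆ (zdGraph d).edgeSet) {z : Site d}
    (hz : z ∉ box d N) (p : (openGraph ω).Walk (0 : Site d) z) (hp : p.IsPath) :
    ∃ f : Site d → Site d → ℝ, (∀ x y, f x y = -f y x) ∧ (∀ x y, f x y ≠ 0 → (zdGraph d).Adj x y ∧ s(x, y) ∈ ω) ∧
      (∀ x ∈ box d N, x ≠ 0 → ∑ y ∈ (zdGraph d).neighborFinset x, f x y = 0) ∧ ∑ y ∈ (zdGraph d).neighborFinset 0, f 0 y = 1 ∧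
      Summable (fun q : Site d × Site d => f q.1 q.2 ^ 2) ∧ ∑' q : Site d × Site d, f q.1 q.2 ^ 2 ≤ 2 * (p.length : ℝ) := by
  classical
  have hH : ∀ u v : Site d, (openGraph ω).Adj u v → (zdGraph d).Adj u v := fun u v huv =>
    (SimpleGraph.mem_edgeSet (zdGraph d)).1 (hω ((openGraph_adj ω u v).1 huv).1)
  have hz0 : z ≠ 0 := fun h => hz (h ▸ zero_mem_box d N)
  obtain ⟨hsumm, hener⟩ := tsum_sq_dartFlow_le p hp
  refine ⟨fun x y => ((((p.darts.map SimpleGraph.Dart.toProd).count (x, y) : ℕ) : ℝ) -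
      (((p.darts.map SimpleGraph.Dart.toProd).count (y, x) : ℕ) : ℝ)), fun x y => by ring, fun x y hxy => ?_, fun x hx hx0 => ?_, ?_,
    hsumm, hener⟩
  · have hadj := dartFlow_ne_zero p hxy
    exact ⟨hH x y hadj, ((openGraph_adj ω x y).1 hadj).1⟩
  · rw [sum_neighborFinset_dartFlow_eq hH p x, if_neg hx0, if_neg (show x ≠ z from fun h => hz (h ▸ hx))]
    ring
  · rw [sum_neighborFinset_dartFlow_eq hH p 0, if_pos rfl, if_neg (Ne.symm hz0)]
    ring

/-- **`R_eff(0 ↔ Λ(N)ᶜ) ≤ 2·dist_ω(0, z)`**: for `z ∉ Λ(N)` in the open cluster of the root (lattice configuration) there is a unit flow from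
the root, divergence-free on `Λ(N) ∖ {0}`, supported on the open edges, with energy at most twice the CHEMICAL DISTANCE `dist_{openGraph ω}(0,z)`
(a geodesic is a path). [cite: LyonsPeres2016, §2.4] -/
theorem exists_unitFlow_energy_le_two_mul_dist {N : ℕ} {ω : BondConfig (Site d)} (hω : ω ⊆ (zdGraph d).edgeSet) {z : Site d}
    (hz : z ∉ box d N) (hreach : z ∈ openCluster ω (0 : Site d)) :
    ∃ f : Site d → Site d → ℝ, (∀ x y, f x y = -f y x) ∧ (∀ x y, f x y ≠ 0 → (zdGraph d).Adj x y ∧ s(x, y) ∈ ω) ∧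
      (∀ x ∈ box d N, x ≠ 0 → ∑ y ∈ (zdGraph d).neighborFinset x, f x y = 0) ∧ ∑ y ∈ (zdGraph d).neighborFinset 0, f 0 y = 1 ∧
      Summable (fun q : Site d × Site d => f q.1 q.2 ^ 2) ∧
      ∑' q : Site d × Site d, f q.1 q.2 ^ 2 ≤ 2 * ((openGraph ω).dist (0 : Site d) z : ℝ) := by
  obtain ⟨p, hp, hlen⟩ := SimpleGraph.Reachable.exists_path_of_dist (show (openGraph ω).Reachable 0 z from hreach)
  obtain ⟨f, h1, h2, h3, h4, h5, h6⟩ := exists_unitFlow_energy_le_two_mul_length hω hz p hp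
  exact ⟨f, h1, h2, h3, h4, h5, by rwa [hlen] at h6⟩

/-- **`#BOTTLENECKS ≤ 2·CHEMICAL DISTANCE`** (deterministic, lattice configurations, every `d`, `N`): for every `z ∉ Λ(N)` in the open cluster of
the root, **`#{e ∈ Λ(N).sym2 : ω ∖ {e} ∉ A_{N+1}} ≤ 2·dist_{openGraph ω}(0, z)`** — Nash-Williams below (`…IICResistanceNashWilliams`), the path
flow above: along Kesten's IIC, `(log_L N)/2 <` #bottlenecks `≤ R_eff(0 ↔ Λ(N)ᶜ) ≤ 2·(chemical distance to leave Λ(N))`.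
[cite: HeydenreichVanDerHofstad2017, §14.3 Exerc. 14.5] [cite: LyonsPeres2016, §2.4] -/
theorem ncard_pivotal_le_two_mul_dist {N : ℕ} {ω : BondConfig (Site d)} (hω : ω ⊆ (zdGraph d).edgeSet) {z : Site d}
    (hz : z ∉ box d N) (hreach : z ∈ openCluster ω (0 : Site d)) :
    ({e : Sym2 (Site d) | e ∈ (↑((box d N).sym2) : Set (Sym2 (Site d))) ∧ ω \ {e} ∉ siteToBoundary d (N + 1)}.ncard : ℝ) ≤
      2 * ((openGraph ω).dist (0 : Site d) z : ℝ) := by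
  obtain ⟨f, h1, h2, h3, h4, h5, h6⟩ := exists_unitFlow_energy_le_two_mul_dist hω hz hreach
  exact (ncard_pivotal_le_energy hω h1 h2 h3 h4 h5).trans h6

end Summit.CriticalPhenomena.PercolationContinuityZ3.Theorems.Crossing

end
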